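import Summits.BirchSwinnertonDyer.BirchSwinnertonDyer.Theorems.ByReductionTypeAtTwoRankOneAtTwoBigImageOddLocalStubShaAnRationalOnSlicePrimary
import Literature.NumberTheory.EllipticCurves.GrossZagierRationalPointExplicitProofs
import HarnessLib

/-!
# Line `fkl` of crux `RankOneAtTwoBigImageOddLocal` (stmt-BirchSwinnertonDyer-23715, route ByReductionTypeAtTwo):
# what the (5a) witness is worth EXACTLY — `Ш_an = n²·#T² / (2·c·u²·S⁻·k·∏c_ℓ)`

Width prover seat `bsd-line-fkl-p2` (g5); helper file `--supports stmt-BirchSwinnertonDyer-23715`, sequel to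
`…StubShaAnRationalOnSlicePrimary.lean` (p608164: stub (5a) `Ш_an ∈ ℚ^×` from PRIMARY facts).  The Literature theorem
`deriv_entireLFunction_one_eq_div_of_heegnerPoint` (`GrossZagierRationalPointExplicitProofs.lean`) writes Gross–Zagier's
constant of Thm. I.(7.3) in closed form; this file turns it into the EXACT value of Miller's analytic order of `Ш` in the
tree's normalisations, for the use of the line's `2`-adic stubs — it is a DICTIONARY («what the witness is worth»), it
neither proves nor restates the open stub (5b) `stub_shaAnTwoIntegralOnSlice` or the Kolyvagin stubs:

* `leadingLCoeff_eq_explicit_of_heegnerPoint` — for `W` globally minimal of analytic rank one, `K` a Heegner field with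
  odd `d_K` and `L(E^{(d_K)},1) ≠ 0`, a datum `Dt = (f, Λ_E, φ, c)` with Heegner point `P_K`, the reflection `σ`, the
  descended point `P ∈ E(ℚ)` (`ιP = P_K + σP_K`), `k ∈ ℤ` with `cΩ⁻_f = k|Ω⁻(W)|` and `n ∈ ℤ` with `ĥ(P) = n²·Reg`
  (rank one): **`L'(E,1) = c_E·Ω·Reg` with `c_E = n²/(2·c·u²·S⁻·k)`** — Gross–Zagier's (7.2) constant, explicit;
* `shaAn_eq_explicit_of_heegnerPoint` — **`Ш_an(W) = n²·#E(ℚ)_tors² / (2·c·u²·S⁻·k·∏c_ℓ)`** (GZ86 V.(2.2)–(2.3) shape);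
* `padicValRat_two_shaAn_explicit` — on the slice (`#T`, `∏c_ℓ` odd) `ord₂ Ш_an = ord₂ c_E` (g0's
  `padicValRat_two_eq_of_shaAn_eq_of_odd`) with `c_E` now explicit.

Here `u = #𝓞_K^×/2`, `S⁻ = ∑_{a mod |d|}(a/|d|)[a/|d|]⁻_f ∈ ℚ^×` (minus modular symbols of `f` normalised by `Ω⁻_f`,
`im Λ_f = ℤΩ⁻_f/2`), all computable.  Inputs beyond the data: modularity in Version `L` (`hasEntireLFunction_rat`) and the
Gross–Zagier statement shape `GrossZagierFormula N_E W K` (concluded by the named fact `gross_zagier`).  Theorems only;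
no `def`, no `sorry`.  BSD is not proved by any of this.

References: [GrossZagier1986] (7.2)–(7.3) p. 231, V.(2.1)–(2.3), V.§2 pp. 312–313; [Miller2011LMS] §1; [Darmon2004] Prop. 3.11.
-/

noncomputable section

open scoped Classical NumberTheorySymbols

-- `Summit.BirchSwinnertonDyer.BirchSwinnertonDyer.…` repeats the summit name by the tree's layout (single-conjunct summit).
set_option linter.dupNamespace false

namespace Summit.BirchSwinnertonDyer.BirchSwinnertonDyer.Theorems.RankOneAtTwoFkl

open WeierstrassCurve WeierstrassCurve.Affine.Point WeierstrassCurve.QuadraticDescent Literature.NumberTheory.EllipticCurves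
  Literature.NumberTheory.EllipticCurves.ModularForms

section Explicit

variable (W : WeierstrassCurve ℚ) [W.IsElliptic] [W.IsGloballyMinimal] [NeZero (W.conductorNorm ℤ)]
  (K : Type) [Field K] [NumberField K] [NeZero (NumberField.discr K).natAbs]

/-- **Gross–Zagier's (7.2) constant, explicit.**  Setting of `deriv_entireLFunction_one_eq_div_of_heegnerPoint` plus
`ord_{s=1}L(E,s) = 1` (so `L(E,1) = 0`, `w(E) = −1` by parity from modularity `hmod`, and `L^{(r)}(E,1)/r! = L'(E,1)`),
an integer `k` with `c·Ω⁻_f = k·|Ω⁻(W)|` (exists, `exists_int_maninConstant_mul_minusPeriod_eq`) and an integer `n` with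
`ĥ(P) = n²·Reg` (exists in rank one, `exists_int_canonicalHeight_eq_sq_mul_regulator`):
`L'(E,1) = (n²/(2·c·u²·S⁻·k)) · Ω(W) · Reg(E/ℚ)`. [cite: GrossZagier1986, (7.2) and Thm. I.(7.3) (p. 231); V.§2 (pp. 312–313)] -/
theorem leadingLCoeff_eq_explicit_of_heegnerPoint (hmod : exists_isNewformOf) (hr : W.analyticRank = 1)
    (hK : IsImaginaryQuadratic K) (hH : SatisfiesHeegnerHypothesis (W.conductorNorm ℤ) K)
    (hodd : Odd (NumberField.discr K)) (hLt : (W.quadraticTwist (NumberField.discr K : ℚ)).entireLFunction 1 ≠ 0)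
    (hGZF : GrossZagierFormula (W.conductorNorm ℤ) W K) (Dt : ModularParametrizationData W (W.conductorNorm ℤ))
    (Hd : HeegnerDatum (W.conductorNorm ℤ) (NumberField.discr K)) (ι : K →+* ℂ) (PK : (W.baseChange K).toAffine.Point)
    (hι : WeierstrassCurve.Affine.Point.map ι.toRatAlgHom PK = heegnerPointComplex Dt Hd)
    {σ : K →ₐ[ℚ] K} (hσ : σ ≠ AlgHom.id ℚ K) (R : W.toAffine.Point) (hR : incl K W R = PK + conjMap W σ PK)
    {k : ℤ} (hk : (Dt.c : ℝ) * minusPeriod Dt.f = k * W.imaginaryPeriodRat)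
    {n : ℤ} (hn : canonicalHeight R = (n : ℝ) ^ 2 * W.regulator) :
    W.leadingLCoeff = (((((n : ℚ) ^ 2 / (2 * (Dt.c : ℚ) * ((NumberField.Units.torsionOrder K : ℚ) / 2) ^ 2 *
        (∑ a : ZMod (NumberField.discr K).natAbs, (J((a.val : ℤ) | (NumberField.discr K).natAbs) : ℚ) *
          ratMinusSymbol Dt.f ((a.val : ℚ) / (NumberField.discr K).natAbs)) * k) : ℚ) : ℝ) *
        W.realPeriodRat * W.regulator : ℝ) : ℂ) := by
  have hE : hasEntireLFunction_rat := hasEntireLFunction_rat_of_exists_isNewformOf hmod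
  have h0 : W.entireLFunction 1 = 0 := entireLFunction_one_eq_zero_of_analyticRank_eq_one hr
  have hw : W.rootNumber = -1 := by
    rcases W.rootNumber_eq_one_or with hw | hw
    · exact absurd ((even_analyticRank_iff_of_exists_isNewformOf hmod W).mpr hw) (by rw [hr]; exact Nat.not_even_one)
    · exact hw
  obtain ⟨hlead, -⟩ := leadingLCoeff_eq_deriv_of_analyticRank_eq_one hr
  have h := deriv_entireLFunction_one_eq_div_of_heegnerPoint hE W h0 hw K hK hH hodd hLt hGZF Dt Hd ι PK hι hσ R hR
  have hΩm : W.imaginaryPeriodRat ≠ 0 := W.imaginaryPeriodRat_pos.ne'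
  have hκ : (Dt.c : ℝ) * minusPeriod Dt.f / W.imaginaryPeriodRat = k := by
    rw [div_eq_iff hΩm, hk]
  rw [hlead, h, hκ, hn, Complex.ofReal_inj]
  push_cast
  ring

/-- **`Ш_an(W) = n²·#E(ℚ)_tors² / (2·c·u²·S⁻·k·∏c_ℓ)` — the analytic order of `Ш` of a rank-one curve, EXACTLY**, in the
setting of `leadingLCoeff_eq_explicit_of_heegnerPoint` (Miller's `Ш_an = L'(E,1)·#T²/(Ω·∏c_ℓ·Reg)`; GZ86 V.(2.2)–(2.3):
«if `Ш` is finite and `rank = 1`, BSD predicts `#Ш = …·[E(ℚ):ℤP]²`»).  Every factor is computable: the Manin constant `c`,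
`u = #𝓞_K^×/2`, the twisted minus symbol sum `S⁻` of `f`, the minus period ratio `k`, the height index `n` of
`P = P_K + P̄_K`, `#T`, `∏c_ℓ`. [cite: GrossZagier1986, V.(2.2)–(2.3) and Thm. I.(7.3)] [cite: Miller2011LMS, §1 (arXiv:1010.2431 p. 3)] -/
theorem shaAn_eq_explicit_of_heegnerPoint (hmod : exists_isNewformOf) (hr : W.analyticRank = 1)
    (hK : IsImaginaryQuadratic K) (hH : SatisfiesHeegnerHypothesis (W.conductorNorm ℤ) K)
    (hodd : Odd (NumberField.discr K)) (hLt : (W.quadraticTwist (NumberField.discr K : ℚ)).entireLFunction 1 ≠ 0)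
    (hGZF : GrossZagierFormula (W.conductorNorm ℤ) W K) (Dt : ModularParametrizationData W (W.conductorNorm ℤ))
    (Hd : HeegnerDatum (W.conductorNorm ℤ) (NumberField.discr K)) (ι : K →+* ℂ) (PK : (W.baseChange K).toAffine.Point)
    (hι : WeierstrassCurve.Affine.Point.map ι.toRatAlgHom PK = heegnerPointComplex Dt Hd)
    {σ : K →ₐ[ℚ] K} (hσ : σ ≠ AlgHom.id ℚ K) (R : W.toAffine.Point) (hR : incl K W R = PK + conjMap W σ PK)
    {k : ℤ} (hk : (Dt.c : ℝ) * minusPeriod Dt.f = k * W.imaginaryPeriodRat)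
    {n : ℤ} (hn : canonicalHeight R = (n : ℝ) ^ 2 * W.regulator) :
    shaAn W = ((((n : ℚ) ^ 2 / (2 * (Dt.c : ℚ) * ((NumberField.Units.torsionOrder K : ℚ) / 2) ^ 2 *
        (∑ a : ZMod (NumberField.discr K).natAbs, (J((a.val : ℤ) | (NumberField.discr K).natAbs) : ℚ) *
          ratMinusSymbol Dt.f ((a.val : ℚ) / (NumberField.discr K).natAbs)) * k)) *
        (W.torsionOrder : ℚ) ^ 2 / (W.tamagawaProduct : ℚ) : ℚ) : ℂ) :=
  shaAn_eq_ratCast_of_leadingLCoeff_eq W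
    (leadingLCoeff_eq_explicit_of_heegnerPoint W K hmod hr hK hH hodd hLt hGZF Dt Hd ι PK hι hσ R hR hk hn)

/-- **On the slice, `ord₂ Ш_an = ord₂ (n²/(2·c·u²·S⁻·k))`**: with `#E(ℚ)_tors` and `∏c_ℓ` ODD (crux
`RankOneAtTwoBigImageOddLocal`), g0's `padicValRat_two_eq_of_shaAn_eq_of_odd` applied to the explicit (7.2) constant.
So the open stub (5b) («`0 ≤ ord₂ Ш_an`», not proved or restated here) reads, curve by curve,
`ord₂ S⁻ + ord₂ k + ord₂ c + 2·ord₂ u + 1 ≤ 2·ord₂ n` — a statement about computable invariants of `(E, K, f)`.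
[cite: GrossZagier1986, V.(2.2)–(2.3) and Thm. I.(7.3)] -/
theorem padicValRat_two_shaAn_explicit (hmod : exists_isNewformOf) (hr : W.analyticRank = 1)
    (hK : IsImaginaryQuadratic K) (hH : SatisfiesHeegnerHypothesis (W.conductorNorm ℤ) K)
    (hodd : Odd (NumberField.discr K)) (hLt : (W.quadraticTwist (NumberField.discr K : ℚ)).entireLFunction 1 ≠ 0)
    (hGZF : GrossZagierFormula (W.conductorNorm ℤ) W K) (Dt : ModularParametrizationData W (W.conductorNorm ℤ))
    (Hd : HeegnerDatum (W.conductorNorm ℤ) (NumberField.discr K)) (ι : K →+* ℂ) (PK : (W.baseChange K).toAffine.Point)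
    (hι : WeierstrassCurve.Affine.Point.map ι.toRatAlgHom PK = heegnerPointComplex Dt Hd)
    {σ : K →ₐ[ℚ] K} (hσ : σ ≠ AlgHom.id ℚ K) (R : W.toAffine.Point) (hR : incl K W R = PK + conjMap W σ PK)
    {k : ℤ} (hk : (Dt.c : ℝ) * minusPeriod Dt.f = k * W.imaginaryPeriodRat)
    {n : ℤ} (hn : canonicalHeight R = (n : ℝ) ^ 2 * W.regulator)
    (hT : Odd W.torsionOrder) (hc : Odd W.tamagawaProduct) {q : ℚ} (hq : shaAn W = (q : ℂ)) :
    padicValRat 2 q = padicValRat 2 ((n : ℚ) ^ 2 / (2 * (Dt.c : ℚ) * ((NumberField.Units.torsionOrder K : ℚ) / 2) ^ 2 *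
        (∑ a : ZMod (NumberField.discr K).natAbs, (J((a.val : ℤ) | (NumberField.discr K).natAbs) : ℚ) *
          ratMinusSymbol Dt.f ((a.val : ℚ) / (NumberField.discr K).natAbs)) * k)) :=
  padicValRat_two_eq_of_shaAn_eq_of_odd W
    (leadingLCoeff_eq_explicit_of_heegnerPoint W K hmod hr hK hH hodd hLt hGZF Dt Hd ι PK hι hσ R hR hk hn) hq hT hc

end Explicit

end Summit.BirchSwinnertonDyer.BirchSwinnertonDyer.Theorems.RankOneAtTwoFkl

end
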